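import Summits.HodgeConjecture.HodgeConjecture.Theorems.F0P6LD1ThetaCharacterPin
import Summits.HodgeConjecture.HodgeConjecture.Theorems.F0LD2CurveHolCotFormsArchCentre
import Summits.HodgeConjecture.HodgeConjecture.Theorems.F0LD2ThetaSeamCharacter
import Literature.NumberTheory.Automorphic.Liu2021.Def411ChiAutomorphicQuotientDescent
import HarnessLib

-- As in the lineage (`ThetaLiftFromLineCentralCharacter`, `F0P6LD1ThetaCharacterPin`): statements over the theta-kernel datum elaborate to very large
-- types; elaborate sequentially.
set_option Elab.async false

/-!
# Crux `HLiu418`, line LD2 (`stub_S1b_facts` in-house), organ B₂ — χ-DESCENT at `n = 2` along an ABSTRACT pinned transport `ιA`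
# (the theta character of a holomorphic-cotangent `P` of a CM unitary CURVE is `χ̃ = chiQuot a χ` for a genuine `χ ∈ Chi`)

Cell hodgecm-mathlib (D-0151), FLOOR 0; crux item `HLiu418` = stmt-HodgeConjecture-24832 (socket `Cruxes/HLiu418/Lines/F0_AlbCm.lean :249`
`stub_S1b_facts`); half-A line LD2, skeleton `F0/P6/LD/LD2-plan/g0/StubS1bfacts.inhouse.skeleton.v5.lean` (e8da573259aec245), organ B₂
`ThetaFinComponent₂` (:202).  Seat LD2-p02 (g0).  THEOREMS ONLY (no `def`, no instance, no notation, no named fact, no `sorry`);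
`--supports stmt-HodgeConjecture-24832 --as helper`.

WHAT.  The abstract-transport, rank-2, CONE-frame twins of ★ `Liu2021.ThetaLiftFromLineCentralCharacter.centralCharacter_eq_charCM` (§4 there),
★ `…charCM_archCentre_eq_one_of_holCotForm` (§5 there, typed for `N = 3` and the ball frame `(ι, H, T)`) and ★ `Liu2021.ThetaLiftFromLineChiDescent`
(§1–§2 there), for an ABSTRACT `ιA : U(H)(𝔸) →* U(diag dV)(𝔸)` pinned by its matrix formula `↑(ιA k) = g_𝔸⁻¹ k g_𝔸` (the LD organs' frame; the
centre then goes to the centre, ★ `frameTransport_adelicCenter`) and carrying rational points to rational points: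

* §1 `centralCharacter_eq_charCM_of_starProjection_ne_zero` (generic rank `N`) — if the centre acts on the discrete `P` through `ψ` and
  `pr_P [Θ̃_Ψ(ξ) ∘ ιA] ≠ 0` (ANY square-integrability witness), then `ψ(u) = ξ([u·1_W])` for every `u ∈ U(1)(𝔸_{L⁺})` — the projection commutes
  with `R` (★ `ClosedSubrep.starProjection_map_apply`) and ★ `F0P6LD1ThetaCharacterPin.rightRegular_adelicCenter_toLp_transport_charCM` (LD1-p02 (g0)).
* §2 `charCM_archCentre_eq_one_of_holCotForm₂` (`N = 2`, cone frame `𝔣 : ConeFrame L H w₁`) — if moreover `P` contains a non-zero class of a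
  weight-`(-1)` holomorphic cotangent form `f ∈ holCotForms₂ … w₁ 𝔣`, then `ξ([(y,1)·1_W]) = 1` for every archimedean norm-one unit `y`
  (§1 + ★ `F0LD2CurveHolCotFormsArchCentre.centralCharacter_archCentre_eq_one₂`); `exists_chi_chiQuot_eq_of_holCotForm₂` — hence `ξ = chiQuot a χ`
  for some `χ ∈ Chi L⁺ L c̄` (★ `Def411WeilCarriers.exists_chi_chiQuot_eq_of_archUnit`).
* §3 `exists_chi_starProjection_ne_zero_of_holCotForm₂` — packaged with the seam: `MeetsThetaLiftFromLine L 2 H e₁ dV hdV hdV0 P μ hμ a ιA` and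
  `P ∋ [f] ≠ 0`, `f ∈ holCotForms₂`, give a majorant witness, a finite invariant measure, a Schwartz–Bruhat `Φ` and a GENUINE `χ ∈ Chi L⁺ L c̄` with
  `pr_P [Θ̃_Φ(charCM (chiQuot a χ)) ∘ ιA] ≠ 0` (★ `F0LD2ThetaSeamCharacter.MeetsThetaLiftFromLine.exists_charCM_starProjection_ne_zero` + §2) —
  the input of node B steps (3)–(4) at `n = 2` (organ B₂'s closer).

HONEST LABEL: HC_CM is proved only modulo the 7 printed citations (2 remaining: hLiu418 = stmt-HodgeConjecture-24832, h413 = stmt-HodgeConjecture-24833)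
until rung 0 closes; this file discharges none of them (in-house helper toward organ B₂ of line LD2).

## References
* [Liu2021] Y. Liu, Camb. J. Math. 9 (2021) = arXiv:2102.11518: Def. 4.11 (l. 2090); proof of Prop. 4.13 Case 1 (l. 2131–2137, p. 48); App. D,
  proof of Prop. D.4 (1) (p. 131).
* [GelbartRogawski1991] S. Gelbart, J. Rogawski, Invent. Math. 105 (1991), §3.1 Prop. 3.1.1 p. 455 and Remark p. 457.
* [BorelJacquet1979] A. Borel, H. Jacquet, PSPM 33.1 (1979), §4.6.
-/

set_option autoImplicit false
-- the mandated namespace has the single-problem summit's repeated segment (`HodgeConjecture.HodgeConjecture`)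
set_option linter.dupNamespace false

noncomputable section

open NumberField MeasureTheory IsDedekindDomain
open scoped Matrix ComplexOrder ENNReal

namespace Summit.HodgeConjecture.HodgeConjecture.Cruxes.HLiu418.F0LD2ThetaChiDescent

open _root_.MeasureTheory
open Literature.NumberTheory.Automorphic Literature.NumberTheory.Automorphic.UnitaryGroup
open Literature.NumberTheory.Automorphic.UnitaryGroup.CotangentForms
open Literature.NumberTheory.Automorphic.UnitaryCurveForms
open Literature.NumberTheory.Automorphic.IdeleClassGroup
open Literature.NumberTheory.Automorphic.Liu2021
open Literature.NumberTheory.Automorphic.Liu2021.Def411WeilCarriers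
open Literature.NumberTheory.Automorphic.Liu2021.Def411WeilCarriersDoubling
open Literature.NumberTheory.GelbartRogawski1991 Literature.NumberTheory.GelbartRogawski1991.UnitaryDualPair
open Literature.NumberTheory.Weil1964
open Literature.RepresentationTheory.Liu2021
open Literature.RepresentationTheory.CompactGroups
open Summit.HodgeConjecture.HodgeConjecture.Cruxes.HLiu418.F0P6LD1ThetaCharacterPin
open Summit.HodgeConjecture.HodgeConjecture.Cruxes.HLiu418.F0LD2CurveHolCotFormsArchCentre
open Summit.HodgeConjecture.HodgeConjecture.Cruxes.HLiu418.F0LD2ThetaSeamCharacter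

/-! ## §1 The theta character reads the central character, through the projection to `P` (generic rank `N`) -/

section Central

variable (L : Type) [Field L] [NumberField L] [IsCMField L] (N : ℕ) (H : Matrix (Fin N) (Fin N) L)
  {n' : ℕ} (e₁ : Fin N × Fin 1 ≃ Fin n') (dV : Fin N → L) (hdV : ∀ i, IsCMField.complexConj L (dV i) = dV i)
  (hdV0 : ∀ i, dV i ≠ 0) (g : GL (Fin N) L)
  (μ : Literature.NumberTheory.Automorphic.IdeleClassGroup L →ₜ* Circle) (hμ : IsConjugateSymplectic L μ) (a : (↥(maximalRealSubfield L))ˣ)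
  (hρ : HasThetaMajorants fun
      (p : ↥(UnitaryGroup.adelic (↥(maximalRealSubfield L)) L (IsCMField.complexConj L) N (Matrix.diagonal dV)) ×
        ↥(UnitaryGroup.adelic (↥(maximalRealSubfield L)) L (IsCMField.complexConj L) 1 (JW (↥(maximalRealSubfield L)) L a)))
      (Φ : piSchwartzBruhat (↥(maximalRealSubfield L)) (Fin n')) =>
        (pairRep (↥(maximalRealSubfield L)) L (IsCMField.complexConj L) N 1 e₁ (Matrix.diagonal dV) (JW (↥(maximalRealSubfield L)) L a)
          (chiSplittingLine L e₁ dV hdV hdV0 (toHeckeCharacter L μ) (isUnitary_toHeckeCharacter L μ)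
            ((isOscillatorChar_toHeckeCharacter_iff μ).mpr hμ) (TW (↥(maximalRealSubfield L)) a)
            (isUnit_det_TW (↥(maximalRealSubfield L)) a) (JW (↥(maximalRealSubfield L)) L a) (JW_eq (↥(maximalRealSubfield L)) L a))) p Φ)
  (ιA : (adelicGroupData (↥(maximalRealSubfield L)) L (IsCMField.complexConj L) N H).Adelic →*
    ↥(UnitaryGroup.adelic (↥(maximalRealSubfield L)) L (IsCMField.complexConj L) N (Matrix.diagonal dV)))
  (hιA : ∀ k, ((ιA k : ↥(UnitaryGroup.adelic (↥(maximalRealSubfield L)) L (IsCMField.complexConj L) N (Matrix.diagonal dV))) :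
      GL (Fin N) (AdeleRing (𝓞 L) L)) =
    (toAdeleGL L g)⁻¹ * adelicVal (↥(maximalRealSubfield L)) L (IsCMField.complexConj L) N H k * toAdeleGL L g)
  (hιArat : ∀ γ : (adelicGroupData (↥(maximalRealSubfield L)) L (IsCMField.complexConj L) N H).Rational,
    ιA ((adelicGroupData (↥(maximalRealSubfield L)) L (IsCMField.complexConj L) N H).toAdelic γ) ∈
      (UnitaryGroup.toAdelic (↥(maximalRealSubfield L)) L (IsCMField.complexConj L) N (Matrix.diagonal dV)).range)

variable
  [CompactSpace (↥(UnitaryGroup.adelic (↥(maximalRealSubfield L)) L (IsCMField.complexConj L) N (Matrix.diagonal dV)) ⧸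
    (UnitaryGroup.toAdelic (↥(maximalRealSubfield L)) L (IsCMField.complexConj L) N (Matrix.diagonal dV)).range)]
  [MeasurableSpace (↥(UnitaryGroup.adelic (↥(maximalRealSubfield L)) L (IsCMField.complexConj L) 1 (JW (↥(maximalRealSubfield L)) L a)) ⧸
    (UnitaryGroup.toAdelic (↥(maximalRealSubfield L)) L (IsCMField.complexConj L) 1 (JW (↥(maximalRealSubfield L)) L a)).range)]
  (μW : Measure (↥(UnitaryGroup.adelic (↥(maximalRealSubfield L)) L (IsCMField.complexConj L) 1 (JW (↥(maximalRealSubfield L)) L a)) ⧸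
    (UnitaryGroup.toAdelic (↥(maximalRealSubfield L)) L (IsCMField.complexConj L) 1 (JW (↥(maximalRealSubfield L)) L a)).range))
  (Ψ : piSchwartzBruhat (↥(maximalRealSubfield L)) (Fin n'))
  [BorelSpace (↥(UnitaryGroup.adelic (↥(maximalRealSubfield L)) L (IsCMField.complexConj L) 1 (JW (↥(maximalRealSubfield L)) L a)) ⧸
    (UnitaryGroup.toAdelic (↥(maximalRealSubfield L)) L (IsCMField.complexConj L) 1 (JW (↥(maximalRealSubfield L)) L a)).range)]
  [IsFiniteMeasure μW]
  [SMulInvariantMeasure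
    ↥(UnitaryGroup.adelic (↥(maximalRealSubfield L)) L (IsCMField.complexConj L) 1 (JW (↥(maximalRealSubfield L)) L a))
    (↥(UnitaryGroup.adelic (↥(maximalRealSubfield L)) L (IsCMField.complexConj L) 1 (JW (↥(maximalRealSubfield L)) L a)) ⧸
      (UnitaryGroup.toAdelic (↥(maximalRealSubfield L)) L (IsCMField.complexConj L) 1 (JW (↥(maximalRealSubfield L)) L a)).range) μW]
  (ν : Measure (adelicGroupData (↥(maximalRealSubfield L)) L (IsCMField.complexConj L) N H).automorphicQuotient)
  [(adelicGroupData (↥(maximalRealSubfield L)) L (IsCMField.complexConj L) N H).IsAutomorphicMeasure ν]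

include hιA hιArat

set_option maxHeartbeats 1600000 in
/-- **The theta character IS the central character, along an abstract pinned transport** [Liu2021, l. 2137 «the central character `χ` of `π`»]:
if the centre `u ↦ u·1_H` acts on the discrete automorphic `P` through `ψ` (★ `DiscreteAutomorphicRep.exists_centralCharacter_adelicCenter`) and the
projection to `P` of the class `[Θ̃_Ψ(ξ) ∘ ιA]` (any square-integrability witness `hθ`) is non-zero, then `ψ(u) = ξ([u·1_W])` for EVERY
`u ∈ U(1)(𝔸_{L⁺})`: `pr_P` commutes with the unitary `R` (★ `ClosedSubrep.starProjection_map_apply`) and the centre acts on the class through `ξ`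
(★ `F0P6LD1ThetaCharacterPin.rightRegular_adelicCenter_toLp_transport_charCM`, which uses the pin `↑(ιA k) = g_𝔸⁻¹ k g_𝔸` through ★
`frameTransport_adelicCenter` and `hιArat` for left invariance).
[cite: Liu2021, proof of Prop. 4.13 Case 1 l. 2136–2137] [cite: GelbartRogawski1991, §3.1 Remark p. 457] [cite: BorelJacquet1979, §4.6] -/
theorem centralCharacter_eq_charCM_of_starProjection_ne_zero
    (P : DiscreteAutomorphicRep (adelicGroupData (↥(maximalRealSubfield L)) L (IsCMField.complexConj L) N H) ν)
    {ψ : ↥(adelicOne (↥(maximalRealSubfield L)) L (IsCMField.complexConj L)) →* ℂˣ}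
    (hψ : ∀ (u : ↥(adelicOne (↥(maximalRealSubfield L)) L (IsCMField.complexConj L))) (f : P.space.toSubmodule),
      P.space.toContRep (adelicCenter (↥(maximalRealSubfield L)) L (IsCMField.complexConj L) N H u) f = ((ψ u : ℂˣ) : ℂ) • f) :
    haveI := normal_range_toAdelic_JW L a
    ∀ (ξ : PontryaginDual (↥(UnitaryGroup.adelic (↥(maximalRealSubfield L)) L (IsCMField.complexConj L) 1 (JW (↥(maximalRealSubfield L)) L a)) ⧸
        (UnitaryGroup.toAdelic (↥(maximalRealSubfield L)) L (IsCMField.complexConj L) 1 (JW (↥(maximalRealSubfield L)) L a)).range))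
      (hθ : MemLp (toQuotFun (adelicGroupData (↥(maximalRealSubfield L)) L (IsCMField.complexConj L) N H) fun x =>
        (lineThetaKernelDatum L N e₁ dV hdV hdV0 μ hμ a hρ).thetaLiftFun μW Ψ (charCM ξ) (ιA x)) 2 ν),
      P.space.toSubmodule.starProjection (MemLp.toLp _ hθ) ≠ 0 →
      ∀ u : ↥(adelicOne (↥(maximalRealSubfield L)) L (IsCMField.complexConj L)),
        ((ψ u : ℂˣ) : ℂ) =
          ((ξ (QuotientGroup.mk (adelicCenter (↥(maximalRealSubfield L)) L (IsCMField.complexConj L) 1 (JW (↥(maximalRealSubfield L)) L a) u)) :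
            Circle) : ℂ) := by
  haveI := normal_range_toAdelic_JW L a
  intro ξ hθ hpr u
  set v := MemLp.toLp _ hθ with hv
  set w := P.space.toSubmodule.starProjection v with hw
  have hwmem : w ∈ P.space.toSubmodule := Submodule.starProjection_apply_mem _ v
  -- `R(u·1_H) w = ξ([u·1_W]) • w` (the projection commutes with the unitary `R`)
  have hR : (adelicGroupData (↥(maximalRealSubfield L)) L (IsCMField.complexConj L) N H).rightRegular ν
      (adelicCenter (↥(maximalRealSubfield L)) L (IsCMField.complexConj L) N H u) w =
      ((ξ (QuotientGroup.mk (adelicCenter (↥(maximalRealSubfield L)) L (IsCMField.complexConj L) 1 (JW (↥(maximalRealSubfield L)) L a) u)) :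
        Circle) : ℂ) • w := by
    rw [hw, ← ContRepresentation.ClosedSubrep.starProjection_map_apply
      ((adelicGroupData (↥(maximalRealSubfield L)) L (IsCMField.complexConj L) N H).isUnitary_rightRegular ν) P.space, hv,
      rightRegular_adelicCenter_toLp_transport_charCM L N H e₁ dV hdV hdV0 g μ hμ a hρ ιA hιA hιArat μW Ψ ν u ξ hθ, map_smul]
  -- `R(u·1_H) w = ψ(u) • w` (central character)
  have hψw : (adelicGroupData (↥(maximalRealSubfield L)) L (IsCMField.complexConj L) N H).rightRegular ν
      (adelicCenter (↥(maximalRealSubfield L)) L (IsCMField.complexConj L) N H u) w = ((ψ u : ℂˣ) : ℂ) • w := by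
    have h := congrArg Subtype.val (hψ u ⟨w, hwmem⟩)
    rw [ContRepresentation.ClosedSubrep.coe_toContRep_apply] at h
    exact h
  have hw0 : w ≠ 0 := hpr
  rw [hψw] at hR
  exact smul_left_injective ℂ hw0 hR

end Central

/-! ## §2 «`χ_∞ = 1`» and the descent `χ̃ ↦ χ ∈ Chi` for a holomorphic-cotangent `P` of the CM unitary CURVE `U(H)` (`N = 2`, cone frame) -/

section Hol

variable (L : Type) [Field L] [NumberField L] [IsCMField L] (H : Matrix (Fin 2) (Fin 2) L)
  {n' : ℕ} (e₁ : Fin 2 × Fin 1 ≃ Fin n') (dV : Fin 2 → L) (hdV : ∀ i, IsCMField.complexConj L (dV i) = dV i)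
  (hdV0 : ∀ i, dV i ≠ 0) (g : GL (Fin 2) L)
  (μ : Literature.NumberTheory.Automorphic.IdeleClassGroup L →ₜ* Circle) (hμ : IsConjugateSymplectic L μ) (a : (↥(maximalRealSubfield L))ˣ)
  (hρ : HasThetaMajorants fun
      (p : ↥(UnitaryGroup.adelic (↥(maximalRealSubfield L)) L (IsCMField.complexConj L) 2 (Matrix.diagonal dV)) ×
        ↥(UnitaryGroup.adelic (↥(maximalRealSubfield L)) L (IsCMField.complexConj L) 1 (JW (↥(maximalRealSubfield L)) L a)))
      (Φ : piSchwartzBruhat (↥(maximalRealSubfield L)) (Fin n')) =>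
        (pairRep (↥(maximalRealSubfield L)) L (IsCMField.complexConj L) 2 1 e₁ (Matrix.diagonal dV) (JW (↥(maximalRealSubfield L)) L a)
          (chiSplittingLine L e₁ dV hdV hdV0 (toHeckeCharacter L μ) (isUnitary_toHeckeCharacter L μ)
            ((isOscillatorChar_toHeckeCharacter_iff μ).mpr hμ) (TW (↥(maximalRealSubfield L)) a)
            (isUnit_det_TW (↥(maximalRealSubfield L)) a) (JW (↥(maximalRealSubfield L)) L a) (JW_eq (↥(maximalRealSubfield L)) L a))) p Φ)
  (ιA : (adelicGroupData (↥(maximalRealSubfield L)) L (IsCMField.complexConj L) 2 H).Adelic →*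
    ↥(UnitaryGroup.adelic (↥(maximalRealSubfield L)) L (IsCMField.complexConj L) 2 (Matrix.diagonal dV)))
  (hιA : ∀ k, ((ιA k : ↥(UnitaryGroup.adelic (↥(maximalRealSubfield L)) L (IsCMField.complexConj L) 2 (Matrix.diagonal dV))) :
      GL (Fin 2) (AdeleRing (𝓞 L) L)) =
    (toAdeleGL L g)⁻¹ * adelicVal (↥(maximalRealSubfield L)) L (IsCMField.complexConj L) 2 H k * toAdeleGL L g)
  (hιArat : ∀ γ : (adelicGroupData (↥(maximalRealSubfield L)) L (IsCMField.complexConj L) 2 H).Rational,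
    ιA ((adelicGroupData (↥(maximalRealSubfield L)) L (IsCMField.complexConj L) 2 H).toAdelic γ) ∈
      (UnitaryGroup.toAdelic (↥(maximalRealSubfield L)) L (IsCMField.complexConj L) 2 (Matrix.diagonal dV)).range)

variable
  [CompactSpace (↥(UnitaryGroup.adelic (↥(maximalRealSubfield L)) L (IsCMField.complexConj L) 2 (Matrix.diagonal dV)) ⧸
    (UnitaryGroup.toAdelic (↥(maximalRealSubfield L)) L (IsCMField.complexConj L) 2 (Matrix.diagonal dV)).range)]
  [MeasurableSpace (↥(UnitaryGroup.adelic (↥(maximalRealSubfield L)) L (IsCMField.complexConj L) 1 (JW (↥(maximalRealSubfield L)) L a)) ⧸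
    (UnitaryGroup.toAdelic (↥(maximalRealSubfield L)) L (IsCMField.complexConj L) 1 (JW (↥(maximalRealSubfield L)) L a)).range)]
  (μW : Measure (↥(UnitaryGroup.adelic (↥(maximalRealSubfield L)) L (IsCMField.complexConj L) 1 (JW (↥(maximalRealSubfield L)) L a)) ⧸
    (UnitaryGroup.toAdelic (↥(maximalRealSubfield L)) L (IsCMField.complexConj L) 1 (JW (↥(maximalRealSubfield L)) L a)).range))
  (Ψ : piSchwartzBruhat (↥(maximalRealSubfield L)) (Fin n'))
  [BorelSpace (↥(UnitaryGroup.adelic (↥(maximalRealSubfield L)) L (IsCMField.complexConj L) 1 (JW (↥(maximalRealSubfield L)) L a)) ⧸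
    (UnitaryGroup.toAdelic (↥(maximalRealSubfield L)) L (IsCMField.complexConj L) 1 (JW (↥(maximalRealSubfield L)) L a)).range)]
  [IsFiniteMeasure μW]
  [SMulInvariantMeasure
    ↥(UnitaryGroup.adelic (↥(maximalRealSubfield L)) L (IsCMField.complexConj L) 1 (JW (↥(maximalRealSubfield L)) L a))
    (↥(UnitaryGroup.adelic (↥(maximalRealSubfield L)) L (IsCMField.complexConj L) 1 (JW (↥(maximalRealSubfield L)) L a)) ⧸
      (UnitaryGroup.toAdelic (↥(maximalRealSubfield L)) L (IsCMField.complexConj L) 1 (JW (↥(maximalRealSubfield L)) L a)).range) μW]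
  (ν : Measure (adelicGroupData (↥(maximalRealSubfield L)) L (IsCMField.complexConj L) 2 H).automorphicQuotient)
  [(adelicGroupData (↥(maximalRealSubfield L)) L (IsCMField.complexConj L) 2 H).IsAutomorphicMeasure ν]
  {w₁ : {w : InfinitePlace L // w.IsComplex}} {𝔣 : ConeFrame L H w₁}

include hιA hιArat

set_option maxHeartbeats 1600000 in
/-- **«`χ_∞ = 1`» for the theta character of a holomorphic-cotangent `P` of the CM unitary curve** [Liu2021, l. 2137], cone frame, abstract pinned
transport: if the discrete automorphic `P` of `U(H)` contains a non-zero class of a weight-`(-1)` holomorphic cotangent form `f ∈ holCotForms₂ … w₁ 𝔣`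
and `pr_P [Θ̃_Ψ(ξ) ∘ ιA] ≠ 0`, then `ξ([(y,1)·1_W]) = 1` for every archimedean norm-one unit `y` — §1 (`ξ([u·1_W]) = ψ_P(u)`, ★
`DiscreteAutomorphicRep.exists_centralCharacter_adelicCenter`) and ★ `F0LD2CurveHolCotFormsArchCentre.centralCharacter_archCentre_eq_one₂`
(`ψ_P((y,1)) = 1`: the archimedean centre `e^{iθ}·1₂` fixes weight-`(-1)` forms).
[cite: Liu2021, proof of Prop. 4.13 Case 1 l. 2137] [cite: BorelJacquet1979, §4.6] -/
theorem charCM_archCentre_eq_one_of_holCotForm₂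
    (P : DiscreteAutomorphicRep (adelicGroupData (↥(maximalRealSubfield L)) L (IsCMField.complexConj L) 2 H) ν)
    {f : (adelicGroupData (↥(maximalRealSubfield L)) L (IsCMField.complexConj L) 2 H).Adelic → ℂ}
    (hf : f ∈ holCotForms₂ (↥(maximalRealSubfield L)) L (IsCMField.complexConj L) H (IsCMField.complexConj_ne_one L)
      (complexConj_smul_infinitePlace L) w₁ 𝔣)
    (h : MemLp (toQuotFun (adelicGroupData (↥(maximalRealSubfield L)) L (IsCMField.complexConj L) 2 H) f) 2 ν)
    (hmem : h.toLp _ ∈ P.space.toSubmodule) (hne : h.toLp _ ≠ 0) :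
    haveI := normal_range_toAdelic_JW L a
    ∀ (ξ : PontryaginDual (↥(UnitaryGroup.adelic (↥(maximalRealSubfield L)) L (IsCMField.complexConj L) 1 (JW (↥(maximalRealSubfield L)) L a)) ⧸
        (UnitaryGroup.toAdelic (↥(maximalRealSubfield L)) L (IsCMField.complexConj L) 1 (JW (↥(maximalRealSubfield L)) L a)).range))
      (hθ : MemLp (toQuotFun (adelicGroupData (↥(maximalRealSubfield L)) L (IsCMField.complexConj L) 2 H) fun x =>
        (lineThetaKernelDatum L 2 e₁ dV hdV hdV0 μ hμ a hρ).thetaLiftFun μW Ψ (charCM ξ) (ιA x)) 2 ν),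
      P.space.toSubmodule.starProjection (MemLp.toLp _ hθ) ≠ 0 →
      ∀ y : ↥(relNormOneInfUnits (↥(maximalRealSubfield L)) L),
        ξ (QuotientGroup.mk (adelicCenter (↥(maximalRealSubfield L)) L (IsCMField.complexConj L) 1 (JW (↥(maximalRealSubfield L)) L a)
          ((cmAdelicOneEquivRelNormOne L).symm (relNormOneInfToIdeles (↥(maximalRealSubfield L)) L y)))) = 1 := by
  haveI := normal_range_toAdelic_JW L a
  intro ξ hθ hpr y
  obtain ⟨ψ, -, -, -, hψ⟩ := P.exists_centralCharacter_adelicCenter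
  have h1 := centralCharacter_eq_charCM_of_starProjection_ne_zero L 2 H e₁ dV hdV hdV0 g μ hμ a hρ ιA hιA hιArat μW Ψ ν P hψ ξ hθ hpr
    ((cmAdelicOneEquivRelNormOne L).symm (relNormOneInfToIdeles (↥(maximalRealSubfield L)) L y))
  have h2 := centralCharacter_archCentre_eq_one₂ (μ := ν) P hψ hf h hmem hne y
  apply Circle.ext
  rw [← h1, h2, Units.val_one, Circle.coe_one]

set_option maxHeartbeats 1600000 in
/-- **The theta character of a holomorphic-cotangent `P` of the CM unitary curve descends to Liu's `χ ∈ Chi`** [Liu2021, l. 2136–2137 + Def. 4.11],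
cone frame, abstract pinned transport: under the hypotheses of `charCM_archCentre_eq_one_of_holCotForm₂`, `ξ = chiQuot a χ` for some `χ ∈ Chi L⁺ L c̄`
(★ `Def411WeilCarriers.exists_chi_chiQuot_eq_of_archUnit`).
[cite: Liu2021, proof of Prop. 4.13 Case 1 (l. 2136–2137); Def. 4.11 (l. 2090)] [cite: BorelJacquet1979, §4.6] -/
theorem exists_chi_chiQuot_eq_of_holCotForm₂
    (P : DiscreteAutomorphicRep (adelicGroupData (↥(maximalRealSubfield L)) L (IsCMField.complexConj L) 2 H) ν)
    {f : (adelicGroupData (↥(maximalRealSubfield L)) L (IsCMField.complexConj L) 2 H).Adelic → ℂ}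
    (hf : f ∈ holCotForms₂ (↥(maximalRealSubfield L)) L (IsCMField.complexConj L) H (IsCMField.complexConj_ne_one L)
      (complexConj_smul_infinitePlace L) w₁ 𝔣)
    (h : MemLp (toQuotFun (adelicGroupData (↥(maximalRealSubfield L)) L (IsCMField.complexConj L) 2 H) f) 2 ν)
    (hmem : h.toLp _ ∈ P.space.toSubmodule) (hne : h.toLp _ ≠ 0) :
    haveI := normal_range_toAdelic_JW L a
    ∀ (ξ : PontryaginDual (↥(UnitaryGroup.adelic (↥(maximalRealSubfield L)) L (IsCMField.complexConj L) 1 (JW (↥(maximalRealSubfield L)) L a)) ⧸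
        (UnitaryGroup.toAdelic (↥(maximalRealSubfield L)) L (IsCMField.complexConj L) 1 (JW (↥(maximalRealSubfield L)) L a)).range))
      (hθ : MemLp (toQuotFun (adelicGroupData (↥(maximalRealSubfield L)) L (IsCMField.complexConj L) 2 H) fun x =>
        (lineThetaKernelDatum L 2 e₁ dV hdV hdV0 μ hμ a hρ).thetaLiftFun μW Ψ (charCM ξ) (ιA x)) 2 ν),
      P.space.toSubmodule.starProjection (MemLp.toLp _ hθ) ≠ 0 →
      ∃ χ' : Chi (↥(maximalRealSubfield L)) L (IsCMField.complexConj L),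
        chiQuot (↥(maximalRealSubfield L)) L (IsCMField.complexConj L) (Algebra.IsQuadraticExtension.finrank_eq_two _ L)
          (IsCMField.complexConj_ne_one (K := L)) a χ' = ξ := by
  haveI := normal_range_toAdelic_JW L a
  intro ξ hθ hpr
  exact Def411WeilCarriers.exists_chi_chiQuot_eq_of_archUnit (↥(maximalRealSubfield L)) L (IsCMField.complexConj L) _ _ a ξ
    (charCM_archCentre_eq_one_of_holCotForm₂ L H e₁ dV hdV hdV0 g μ hμ a hρ ιA hιA hιArat μW Ψ ν P hf h hmem hne ξ hθ hpr)

end Hol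

/-! ## §3 Packaged with the seam: a holomorphic-cotangent `P` meeting the theta lift from `⟨a⟩` along `ιA` meets it at a GENUINE `χ ∈ Chi` -/

section HolSeam

variable (L : Type) [Field L] [NumberField L] [IsCMField L] (H : Matrix (Fin 2) (Fin 2) L)
  {n' : ℕ} (e₁ : Fin 2 × Fin 1 ≃ Fin n') (dV : Fin 2 → L) (hdV : ∀ i, IsCMField.complexConj L (dV i) = dV i)
  (hdV0 : ∀ i, dV i ≠ 0) (g : GL (Fin 2) L)
  (ιA : (adelicGroupData (↥(maximalRealSubfield L)) L (IsCMField.complexConj L) 2 H).Adelic →*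
    ↥(UnitaryGroup.adelic (↥(maximalRealSubfield L)) L (IsCMField.complexConj L) 2 (Matrix.diagonal dV)))
  (hιA : Continuous ιA ∧ ∀ ⦃γ : (adelicGroupData (↥(maximalRealSubfield L)) L (IsCMField.complexConj L) 2 H).Adelic⦄,
    γ ∈ (UnitaryGroup.toAdelic (↥(maximalRealSubfield L)) L (IsCMField.complexConj L) 2 H).range →
      ιA γ ∈ (UnitaryGroup.toAdelic (↥(maximalRealSubfield L)) L (IsCMField.complexConj L) 2 (Matrix.diagonal dV)).range)
  (hpin : ∀ k, ((ιA k : ↥(UnitaryGroup.adelic (↥(maximalRealSubfield L)) L (IsCMField.complexConj L) 2 (Matrix.diagonal dV))) :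
      GL (Fin 2) (AdeleRing (𝓞 L) L)) =
    (toAdeleGL L g)⁻¹ * adelicVal (↥(maximalRealSubfield L)) L (IsCMField.complexConj L) 2 H k * toAdeleGL L g)
  {μA : Measure (adelicGroupData (↥(maximalRealSubfield L)) L (IsCMField.complexConj L) 2 H).automorphicQuotient}
  [(adelicGroupData (↥(maximalRealSubfield L)) L (IsCMField.complexConj L) 2 H).IsAutomorphicMeasure μA]
  [CompactSpace (adelicGroupData (↥(maximalRealSubfield L)) L (IsCMField.complexConj L) 2 H).automorphicQuotient]
  [CompactSpace (↥(UnitaryGroup.adelic (↥(maximalRealSubfield L)) L (IsCMField.complexConj L) 2 (Matrix.diagonal dV)) ⧸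
    (UnitaryGroup.toAdelic (↥(maximalRealSubfield L)) L (IsCMField.complexConj L) 2 (Matrix.diagonal dV)).range)]
  {w₁ : {w : InfinitePlace L // w.IsComplex}} {𝔣 : ConeFrame L H w₁}

include hιA hpin

set_option maxHeartbeats 1600000 in
/-- **NODE B THROUGH STEP (5) AT `n = 2`, abstract pinned transport: a holomorphic-cotangent `P` of the CM unitary curve meeting the theta lift from the
line `⟨a⟩` along `ιA` meets it AT A GENUINE `χ ∈ Chi`** — for some majorant witness, finite invariant measure, Schwartz–Bruhat `Φ` and `χ ∈ Chi L⁺ L c̄`, the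
projection to `P` of the class `[Θ̃_Φ(charCM (chiQuot a χ)) ∘ ιA]` is non-zero (★ `F0LD2ThetaSeamCharacter.MeetsThetaLiftFromLine.exists_charCM_starProjection_ne_zero`
+ `exists_chi_chiQuot_eq_of_holCotForm₂`).  The input of node B steps (3)–(4) (coinvariant junction, irreducible-or-zero) in organ B₂'s closer.
[cite: Liu2021, proof of Prop. 4.13 Case 1 (l. 2131–2137, p. 48); Def. 4.11 (l. 2090)] -/
theorem exists_chi_starProjection_ne_zero_of_holCotForm₂
    (P : DiscreteAutomorphicRep (adelicGroupData (↥(maximalRealSubfield L)) L (IsCMField.complexConj L) 2 H) μA)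
    {f : (adelicGroupData (↥(maximalRealSubfield L)) L (IsCMField.complexConj L) 2 H).Adelic → ℂ}
    (hf : f ∈ holCotForms₂ (↥(maximalRealSubfield L)) L (IsCMField.complexConj L) H (IsCMField.complexConj_ne_one L)
      (complexConj_smul_infinitePlace L) w₁ 𝔣)
    (h : MemLp (toQuotFun (adelicGroupData (↥(maximalRealSubfield L)) L (IsCMField.complexConj L) 2 H) f) 2 μA)
    (hmem : h.toLp _ ∈ P.space.toSubmodule) (hne : h.toLp _ ≠ 0)
    (μ : Literature.NumberTheory.Automorphic.IdeleClassGroup L →ₜ* Circle) (hμ : IsConjugateSymplectic L μ) (a : (↥(maximalRealSubfield L))ˣ)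
    (hmeets : MeetsThetaLiftFromLine L 2 H e₁ dV hdV hdV0 P μ hμ a ιA) :
    letI : MeasurableSpace (↥(UnitaryGroup.adelic (↥(maximalRealSubfield L)) L (IsCMField.complexConj L) 1 (JW (↥(maximalRealSubfield L)) L a)) ⧸
      (UnitaryGroup.toAdelic (↥(maximalRealSubfield L)) L (IsCMField.complexConj L) 1 (JW (↥(maximalRealSubfield L)) L a)).range) := borel _
    haveI := normal_range_toAdelic_JW L a
    ∃ (hρ : HasThetaMajorants fun
      (p : ↥(UnitaryGroup.adelic (↥(maximalRealSubfield L)) L (IsCMField.complexConj L) 2 (Matrix.diagonal dV)) ×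
        ↥(UnitaryGroup.adelic (↥(maximalRealSubfield L)) L (IsCMField.complexConj L) 1 (JW (↥(maximalRealSubfield L)) L a)))
        (Φ : piSchwartzBruhat (↥(maximalRealSubfield L)) (Fin n')) =>
        pairRep (↥(maximalRealSubfield L)) L (IsCMField.complexConj L) 2 1 e₁ (Matrix.diagonal dV) (JW (↥(maximalRealSubfield L)) L a)
          (chiSplittingLine L e₁ dV hdV hdV0 (toHeckeCharacter L μ) (isUnitary_toHeckeCharacter L μ)
            ((isOscillatorChar_toHeckeCharacter_iff μ).mpr hμ) (TW (↥(maximalRealSubfield L)) a)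
            (isUnit_det_TW (↥(maximalRealSubfield L)) a) (JW (↥(maximalRealSubfield L)) L a) (JW_eq (↥(maximalRealSubfield L)) L a))
          p Φ)
      (μW : Measure (↥(UnitaryGroup.adelic (↥(maximalRealSubfield L)) L (IsCMField.complexConj L) 1 (JW (↥(maximalRealSubfield L)) L a)) ⧸
        (UnitaryGroup.toAdelic (↥(maximalRealSubfield L)) L (IsCMField.complexConj L) 1 (JW (↥(maximalRealSubfield L)) L a)).range))
      (_ : IsFiniteMeasure μW)
      (_ : SMulInvariantMeasure ↥(UnitaryGroup.adelic (↥(maximalRealSubfield L)) L (IsCMField.complexConj L) 1 (JW (↥(maximalRealSubfield L)) L a))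
        (↥(UnitaryGroup.adelic (↥(maximalRealSubfield L)) L (IsCMField.complexConj L) 1 (JW (↥(maximalRealSubfield L)) L a)) ⧸
          (UnitaryGroup.toAdelic (↥(maximalRealSubfield L)) L (IsCMField.complexConj L) 1 (JW (↥(maximalRealSubfield L)) L a)).range) μW)
      (Φ : piSchwartzBruhat (↥(maximalRealSubfield L)) (Fin n')) (χ : Chi (↥(maximalRealSubfield L)) L (IsCMField.complexConj L))
      (hθ : MemLp (toQuotFun (adelicGroupData (↥(maximalRealSubfield L)) L (IsCMField.complexConj L) 2 H) fun x =>
        (lineThetaKernelDatum L 2 e₁ dV hdV hdV0 μ hμ a hρ).thetaLiftFun μW Φ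
          (charCM (chiQuot (↥(maximalRealSubfield L)) L (IsCMField.complexConj L) (Algebra.IsQuadraticExtension.finrank_eq_two _ L)
            (IsCMField.complexConj_ne_one (K := L)) a χ)) (ιA x)) 2 μA),
      P.space.toSubmodule.starProjection (MemLp.toLp _ hθ) ≠ 0 := by
  letI : MeasurableSpace (↥(UnitaryGroup.adelic (↥(maximalRealSubfield L)) L (IsCMField.complexConj L) 1 (JW (↥(maximalRealSubfield L)) L a)) ⧸
      (UnitaryGroup.toAdelic (↥(maximalRealSubfield L)) L (IsCMField.complexConj L) 1 (JW (↥(maximalRealSubfield L)) L a)).range) := borel _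
  haveI : BorelSpace (↥(UnitaryGroup.adelic (↥(maximalRealSubfield L)) L (IsCMField.complexConj L) 1 (JW (↥(maximalRealSubfield L)) L a)) ⧸
      (UnitaryGroup.toAdelic (↥(maximalRealSubfield L)) L (IsCMField.complexConj L) 1 (JW (↥(maximalRealSubfield L)) L a)).range) := ⟨rfl⟩
  haveI := normal_range_toAdelic_JW L a
  have hιArat : ∀ γ : (adelicGroupData (↥(maximalRealSubfield L)) L (IsCMField.complexConj L) 2 H).Rational,
      ιA ((adelicGroupData (↥(maximalRealSubfield L)) L (IsCMField.complexConj L) 2 H).toAdelic γ) ∈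
        (UnitaryGroup.toAdelic (↥(maximalRealSubfield L)) L (IsCMField.complexConj L) 2 (Matrix.diagonal dV)).range :=
    fun γ => hιA.2 ⟨γ, rfl⟩
  obtain ⟨hρ, μW, hfin, hinv, Φ, ξ, hθ, hξ⟩ :=
    MeetsThetaLiftFromLine.exists_charCM_starProjection_ne_zero L 2 H e₁ dV hdV hdV0 ιA hιA P μ hμ a hmeets
  obtain ⟨χ', hχ'⟩ :=
    exists_chi_chiQuot_eq_of_holCotForm₂ L H e₁ dV hdV hdV0 g μ hμ a hρ ιA hpin hιArat μW Φ μA P hf h hmem hne ξ hθ hξ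
  subst hχ'
  exact ⟨hρ, μW, hfin, hinv, Φ, χ', hθ, hξ⟩

end HolSeam

end Summit.HodgeConjecture.HodgeConjecture.Cruxes.HLiu418.F0LD2ThetaChiDescent

end
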